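import Summits.KontsevichZagierPeriods.KontsevichZagierPeriods.Theorems.SoloBlindDuplication
import Mathlib.Analysis.SpecialFunctions.Sqrt
import HarnessLib

/-!
# Mixed duplication `B(a, a+½) = 2^{1-2a} B(2a, ½)`, I: the real identities

Legendre's duplication `Γ(a)Γ(a+½) = 2^{1-2a} √π Γ(2a)` has two shadows among two-term Beta
relations: `B(a,a) = 2^{1-2a} B(a,½)` (`SoloBlindDuplication`) and the MIXED one
`B(a,a+½) = 2^{1-2a} B(2a,½)`. The second is realised inside the Kontsevich–Zagier rules by a
chain of ONE-dimensional moves: split `∫₀¹ t^{a-1}(1-t)^{a-½} dt` at `t = ½`, substitute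
`w = φ(t) = 2√(t(1-t))` on each half (a semialgebraic `C¹` bijection onto `(0,1)` from either
side, with inverse branches `t = (1 ∓ √(1-w²))/2`), and add the two resulting integrands on
`(0,1)`: the nested radicals `√((1+√(1-w²))/2) + √((1-√(1-w²))/2) = √(1+w)` collapse the sum to
`2·4^{-a} w^{2a-1}(1-w)^{-½}`.

This file proves the pointwise identities, bounds and integrability; the moves are performed in
`SoloBlindMixedDuplication`.
-/

noncomputable section

open Set MeasureTheory

namespace Summit.KontsevichZagierPeriods.KontsevichZagierPeriods.Theorems

namespace SoloBlind

open Literature.NumberTheory.Transcendental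
open Literature.NumberTheory.Transcendental.KZ
open Literature.Analysis.SpecialFunctions.Selberg

/-! ## The functions -/

/-- The mixed Beta integrand `t^{a-1}(1-t)^{(a+½)-1}` (syntactically that of `betaRep a (a+½)`). -/
def mixFun (a : ℚ) (t : ℝ) : ℝ := t ^ ((a : ℝ) - 1) * (1 - t) ^ ((((a + 1 / 2 : ℚ)) : ℝ) - 1)

/-- The substitution `φ(t) = 2√(t(1-t))`. -/
def mixPhi (t : ℝ) : ℝ := 2 * Real.sqrt (t * (1 - t))

/-- `φ'(t)` in the raw form produced by the derivative rules (`= (1-2t)/√(t(1-t))`). -/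
def mixPhi' (t : ℝ) : ℝ := 2 * ((1 * (1 - t) + t * -1) / (2 * Real.sqrt (t * (1 - t))))

/-- The common factor `(w²/4)^{a-1} · w / (2√(1-w²))` of the two pushed-forward integrands. -/
def mixCore (a : ℚ) (w : ℝ) : ℝ :=
  (w ^ 2 / 4) ^ ((a : ℝ) - 1) * (w / (2 * Real.sqrt (1 - w ^ 2)))

/-- Push-forward of the left half: `mixCore · √((1+√(1-w²))/2)`. -/
def mixGL (a : ℚ) (w : ℝ) : ℝ := mixCore a w * Real.sqrt ((1 + Real.sqrt (1 - w ^ 2)) / 2)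

/-- Push-forward of the right half: `mixCore · √((1-√(1-w²))/2)`. -/
def mixGR (a : ℚ) (w : ℝ) : ℝ := mixCore a w * Real.sqrt ((1 - Real.sqrt (1 - w ^ 2)) / 2)

/-- The target integrand `2·4^{-a} · w^{2a-1}(1-w)^{½-1}` (syntactically `2·4^{-a}` times that of
`betaRep (2a) ½`). -/
def mixG (a : ℚ) (w : ℝ) : ℝ :=
  2 * (4:ℝ) ^ (((-a : ℚ)) : ℝ) *
    (w ^ ((((2 * a : ℚ)) : ℝ) - 1) * (1 - w) ^ (((((1:ℚ) / 2 : ℚ)) : ℝ) - 1))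

/-! ## The substitution `φ` -/

/-- `φ` is differentiable inside `(0,1)` with derivative `mixPhi'`. -/
theorem hasDerivAt_mixPhi {t : ℝ} (h0 : 0 < t) (h1 : t < 1) : HasDerivAt mixPhi (mixPhi' t) t := by
  unfold mixPhi mixPhi'
  exact (((hasDerivAt_id t).mul ((hasDerivAt_id t).const_sub 1)).sqrt
    (mul_pos h0 (by simp only [id]; linarith)).ne').const_mul 2

/-- `|φ'(t)| = |1-2t| / √(t(1-t))`. -/
theorem abs_mixPhi' {t : ℝ} (h0 : 0 < t) (h1 : t < 1) :
    |mixPhi' t| = |1 - 2 * t| / Real.sqrt (t * (1 - t)) := by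
  have hr : 0 < Real.sqrt (t * (1 - t)) := Real.sqrt_pos.mpr (mul_pos h0 (by linarith))
  rw [show mixPhi' t = (1 - 2 * t) / Real.sqrt (t * (1 - t)) by
    unfold mixPhi'; field_simp; ring, abs_div, abs_of_pos hr]

/-- `φ(t)²/4 = t(1-t)`. -/
theorem mixPhi_sq_div_four {t : ℝ} (h : 0 ≤ t * (1 - t)) : mixPhi t ^ 2 / 4 = t * (1 - t) := by
  unfold mixPhi
  rw [mul_pow, Real.sq_sqrt h]
  ring

/-- `√(1 - φ(t)²) = |1 - 2t|`. -/
theorem sqrt_one_sub_mixPhi_sq {t : ℝ} (h : 0 ≤ t * (1 - t)) :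
    Real.sqrt (1 - mixPhi t ^ 2) = |1 - 2 * t| := by
  unfold mixPhi
  rw [mul_pow, Real.sq_sqrt h, show (1:ℝ) - 2 ^ 2 * (t * (1 - t)) = (1 - 2 * t) ^ 2 by ring,
    Real.sqrt_sq_eq_abs]

/-- `φ` is injective on `(0,½)`. -/
theorem injOn_mixPhi_left : InjOn mixPhi (Ioo 0 (1 / 2)) := by
  intro x hx y hy h
  have hx' : 0 ≤ x * (1 - x) := by nlinarith [hx.1, hx.2]
  have hy' : 0 ≤ y * (1 - y) := by nlinarith [hy.1, hy.2]
  have h2 : Real.sqrt (x * (1 - x)) = Real.sqrt (y * (1 - y)) := by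
    unfold mixPhi at h
    linarith
  rw [Real.sqrt_inj hx' hy'] at h2
  have h4 : (x - y) * (1 - x - y) = 0 := by linear_combination h2
  rcases mul_eq_zero.mp h4 with h5 | h5
  · linarith
  · linarith [hx.2, hy.2]

/-- `φ` is injective on `(½,1)`. -/
theorem injOn_mixPhi_right : InjOn mixPhi (Ioo (1 / 2) 1) := by
  intro x hx y hy h
  have hx' : 0 ≤ x * (1 - x) := by nlinarith [hx.1, hx.2]
  have hy' : 0 ≤ y * (1 - y) := by nlinarith [hy.1, hy.2]
  have h2 : Real.sqrt (x * (1 - x)) = Real.sqrt (y * (1 - y)) := by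
    unfold mixPhi at h
    linarith
  rw [Real.sqrt_inj hx' hy'] at h2
  have h4 : (x - y) * (1 - x - y) = 0 := by linear_combination h2
  rcases mul_eq_zero.mp h4 with h5 | h5
  · linarith
  · linarith [hx.1, hy.1]

/-- `0 < φ(t) < 1` for `t ∈ (0,1)`, `t ≠ ½`. -/
theorem mixPhi_mem {t : ℝ} (h0 : 0 < t) (h1 : t < 1) (h : t ≠ 1 / 2) : mixPhi t ∈ Ioo (0:ℝ) 1 := by
  have hu : 0 < t * (1 - t) := mul_pos h0 (by linarith)
  have hu' : t * (1 - t) < 1 / 4 := by nlinarith [sq_pos_of_ne_zero (sub_ne_zero.mpr h)]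
  refine ⟨mul_pos two_pos (Real.sqrt_pos.mpr hu), ?_⟩
  have : Real.sqrt (t * (1 - t)) < 1 / 2 := by
    rw [Real.sqrt_lt' (by norm_num)]
    linarith
  unfold mixPhi
  linarith

/-- The two inverse branches: `φ((1 ∓ √(1-w²))/2) = w` for `w ∈ (0,1)`. -/
theorem mixPhi_branch {w : ℝ} (h0 : 0 < w) (h1 : w < 1) (ε : ℝ) (hε : ε = 1 ∨ ε = -1) :
    mixPhi ((1 + ε * Real.sqrt (1 - w ^ 2)) / 2) = w := by
  have hcsq : Real.sqrt (1 - w ^ 2) ^ 2 = 1 - w ^ 2 := Real.sq_sqrt (by nlinarith)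
  have hε2 : ε ^ 2 = 1 := by rcases hε with rfl | rfl <;> norm_num
  have hu : (1 + ε * Real.sqrt (1 - w ^ 2)) / 2 * (1 - (1 + ε * Real.sqrt (1 - w ^ 2)) / 2) =
      (w / 2) ^ 2 := by
    have : (1 + ε * Real.sqrt (1 - w ^ 2)) / 2 * (1 - (1 + ε * Real.sqrt (1 - w ^ 2)) / 2) =
        (1 - ε ^ 2 * Real.sqrt (1 - w ^ 2) ^ 2) / 4 := by ring
    rw [this, hε2, hcsq]
    ring
  unfold mixPhi
  rw [hu, Real.sqrt_sq (by linarith)]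
  ring

/-- `φ` maps `(0,½)` onto `(0,1)`. -/
theorem image_mixPhi_left : Ioo (0:ℝ) 1 = mixPhi '' Ioo 0 (1 / 2) := by
  ext w
  constructor
  · rintro ⟨h0, h1⟩
    have hc0 : 0 < Real.sqrt (1 - w ^ 2) := Real.sqrt_pos.mpr (by nlinarith)
    have hc1 : Real.sqrt (1 - w ^ 2) < 1 := by
      rw [Real.sqrt_lt' one_pos]
      nlinarith
    refine ⟨(1 + (-1) * Real.sqrt (1 - w ^ 2)) / 2, ⟨by linarith, by linarith⟩,
      mixPhi_branch h0 h1 (-1) (Or.inr rfl)⟩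
  · rintro ⟨t, ⟨h0, h1⟩, rfl⟩
    exact mixPhi_mem h0 (by linarith) (by linarith)

/-- `φ` maps `(½,1)` onto `(0,1)`. -/
theorem image_mixPhi_right : Ioo (0:ℝ) 1 = mixPhi '' Ioo (1 / 2) 1 := by
  ext w
  constructor
  · rintro ⟨h0, h1⟩
    have hc0 : 0 < Real.sqrt (1 - w ^ 2) := Real.sqrt_pos.mpr (by nlinarith)
    have hc1 : Real.sqrt (1 - w ^ 2) < 1 := by
      rw [Real.sqrt_lt' one_pos]
      nlinarith
    refine ⟨(1 + 1 * Real.sqrt (1 - w ^ 2)) / 2, ⟨by linarith, by linarith⟩,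
      mixPhi_branch h0 h1 1 (Or.inl rfl)⟩
  · rintro ⟨t, ⟨h0, h1⟩, rfl⟩
    exact mixPhi_mem (by linarith) h1 (by linarith)

/-! ## The pull-back identities -/

/-- `t^{a-1}(1-t)^{(a+½)-1} = (t(1-t))^{a-1} √(1-t)` on `(0,1)`. -/
theorem mixFun_eq (a : ℚ) {t : ℝ} (h0 : 0 < t) (h1 : t < 1) :
    mixFun a t = (t * (1 - t)) ^ ((a : ℝ) - 1) * Real.sqrt (1 - t) := by
  unfold mixFun
  rw [show (((a + 1 / 2 : ℚ)) : ℝ) - 1 = ((a : ℝ) - 1) + 1 / 2 by push_cast; ring,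
    Real.rpow_add (by linarith : (0:ℝ) < 1 - t), ← Real.sqrt_eq_rpow (1 - t),
    Real.mul_rpow h0.le (by linarith : (0:ℝ) ≤ 1 - t)]
  ring

/-- Left pull-back: `t^{a-1}(1-t)^{a-½} = gL(φ t)·|φ' t|` on `(0,½)`. -/
theorem mix_pullback_left (a : ℚ) {t : ℝ} (ht : t ∈ Ioo (0:ℝ) (1 / 2)) :
    mixFun a t = mixGL a (mixPhi t) * |mixPhi' t| := by
  obtain ⟨h0, h1⟩ := ht
  have hu : 0 < t * (1 - t) := mul_pos h0 (by linarith)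
  have hr : Real.sqrt (t * (1 - t)) ≠ 0 := (Real.sqrt_pos.mpr hu).ne'
  have hd : 0 < 1 - 2 * t := by linarith
  have hd0 : (1:ℝ) - 2 * t ≠ 0 := hd.ne'
  have hφ : mixPhi t = 2 * Real.sqrt (t * (1 - t)) := rfl
  rw [mixFun_eq a h0 (by linarith), mixGL, mixCore, mixPhi_sq_div_four hu.le,
    sqrt_one_sub_mixPhi_sq hu.le, abs_mixPhi' h0 (by linarith), abs_of_pos hd,
    show (1 + (1 - 2 * t)) / 2 = 1 - t by ring, hφ]
  have hone : 2 * Real.sqrt (t * (1 - t)) / (2 * (1 - 2 * t)) *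
      ((1 - 2 * t) / Real.sqrt (t * (1 - t))) = 1 := by
    rw [div_mul_div_comm, div_eq_one_iff_eq (mul_ne_zero (mul_ne_zero two_ne_zero hd0) hr)]
    ring
  calc (t * (1 - t)) ^ ((a : ℝ) - 1) * Real.sqrt (1 - t)
      = (t * (1 - t)) ^ ((a : ℝ) - 1) * Real.sqrt (1 - t) * (2 * Real.sqrt (t * (1 - t)) /
          (2 * (1 - 2 * t)) * ((1 - 2 * t) / Real.sqrt (t * (1 - t)))) := by rw [hone, mul_one]
    _ = _ := by ring

/-- Right pull-back: `t^{a-1}(1-t)^{a-½} = gR(φ t)·|φ' t|` on `(½,1)`. -/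
theorem mix_pullback_right (a : ℚ) {t : ℝ} (ht : t ∈ Ioo ((1:ℝ) / 2) 1) :
    mixFun a t = mixGR a (mixPhi t) * |mixPhi' t| := by
  obtain ⟨h0, h1⟩ := ht
  have h0' : 0 < t := by linarith
  have hu : 0 < t * (1 - t) := mul_pos h0' (by linarith)
  have hr : Real.sqrt (t * (1 - t)) ≠ 0 := (Real.sqrt_pos.mpr hu).ne'
  have hd : 0 < 2 * t - 1 := by linarith
  have hd0 : (2:ℝ) * t - 1 ≠ 0 := hd.ne'
  have hφ : mixPhi t = 2 * Real.sqrt (t * (1 - t)) := rfl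
  rw [mixFun_eq a h0' h1, mixGR, mixCore, mixPhi_sq_div_four hu.le,
    sqrt_one_sub_mixPhi_sq hu.le, abs_mixPhi' h0' h1, abs_sub_comm,
    abs_of_pos hd,
    show (1 - (2 * t - 1)) / 2 = 1 - t by ring, hφ]
  have hone : 2 * Real.sqrt (t * (1 - t)) / (2 * (2 * t - 1)) *
      ((2 * t - 1) / Real.sqrt (t * (1 - t))) = 1 := by
    rw [div_mul_div_comm, div_eq_one_iff_eq (mul_ne_zero (mul_ne_zero two_ne_zero hd0) hr)]
    ring
  calc (t * (1 - t)) ^ ((a : ℝ) - 1) * Real.sqrt (1 - t)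
      = (t * (1 - t)) ^ ((a : ℝ) - 1) * Real.sqrt (1 - t) * (2 * Real.sqrt (t * (1 - t)) /
          (2 * (2 * t - 1)) * ((2 * t - 1) / Real.sqrt (t * (1 - t)))) := by rw [hone, mul_one]
    _ = _ := by ring

/-! ## The branch sum -/

/-- The nested-radical identity `√((1+c)/2) + √((1-c)/2) = √(1+w)`, `c = √(1-w²)`, `0 < w < 1`. -/
theorem nested_radical {w : ℝ} (h0 : 0 < w) (h1 : w < 1) :
    Real.sqrt ((1 + Real.sqrt (1 - w ^ 2)) / 2) + Real.sqrt ((1 - Real.sqrt (1 - w ^ 2)) / 2) =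
      Real.sqrt (1 + w) := by
  set c := Real.sqrt (1 - w ^ 2) with hc
  have hc0 : 0 ≤ c := Real.sqrt_nonneg _
  have hc1 : c ≤ 1 := by
    rw [hc, Real.sqrt_le_one]
    nlinarith
  have hcsq : c ^ 2 = 1 - w ^ 2 := Real.sq_sqrt (by nlinarith)
  have hA : 0 ≤ (1 + c) / 2 := by linarith
  have hB : 0 ≤ (1 - c) / 2 := by linarith
  have hAB : Real.sqrt ((1 + c) / 2) * Real.sqrt ((1 - c) / 2) = w / 2 := by
    rw [← Real.sqrt_mul hA, show (1 + c) / 2 * ((1 - c) / 2) = (1 - c ^ 2) / 4 by ring, hcsq,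
      show (1 - (1 - w ^ 2)) / 4 = (w / 2) ^ 2 by ring, Real.sqrt_sq (by linarith)]
  rw [← Real.sqrt_sq (add_nonneg (Real.sqrt_nonneg ((1 + c) / 2)) (Real.sqrt_nonneg _)),
    add_sq, Real.sq_sqrt hA, Real.sq_sqrt hB, mul_assoc, hAB]
  congr 1
  ring

/-- `mixCore(w) · √(1+w) = 2·4^{-a} w^{2a-1}(1-w)^{-½}` on `(0,1)`. -/
theorem mixCore_mul_sqrt (a : ℚ) {w : ℝ} (h0 : 0 < w) (h1 : w < 1) :
    mixCore a w * Real.sqrt (1 + w) = mixG a w := by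
  have hs1 : Real.sqrt (1 - w) ≠ 0 := (Real.sqrt_pos.mpr (by linarith)).ne'
  have hs2 : Real.sqrt (1 + w) ≠ 0 := (Real.sqrt_pos.mpr (by linarith)).ne'
  have h4 : (4:ℝ) ^ (a : ℝ) ≠ 0 := (Real.rpow_pos_of_pos (by norm_num) _).ne'
  have hc : Real.sqrt (1 - w ^ 2) = Real.sqrt (1 - w) * Real.sqrt (1 + w) := by
    rw [show (1:ℝ) - w ^ 2 = (1 - w) * (1 + w) by ring, Real.sqrt_mul (by linarith)]
  have hA : (w ^ 2 / 4) ^ ((a : ℝ) - 1) = w ^ (2 * (a : ℝ) - 1) / w / ((4:ℝ) ^ (a : ℝ) / 4) := by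
    rw [Real.div_rpow (sq_nonneg w) (by norm_num : (0:ℝ) ≤ 4), ← Real.rpow_natCast w 2,
      ← Real.rpow_mul h0.le, Real.rpow_sub_one (by norm_num : (4:ℝ) ≠ 0),
      show ((2:ℕ) : ℝ) * ((a : ℝ) - 1) = (2 * (a : ℝ) - 1) - 1 by push_cast; ring,
      Real.rpow_sub_one h0.ne']
  have hB : (1 - w) ^ (((((1:ℚ) / 2 : ℚ)) : ℝ) - 1) = (Real.sqrt (1 - w))⁻¹ := by
    rw [Real.sqrt_eq_rpow, ← Real.rpow_neg_one, ← Real.rpow_mul (by linarith : (0:ℝ) ≤ 1 - w)]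
    push_cast
    norm_num
  have hC : (4:ℝ) ^ (((-a : ℚ)) : ℝ) = ((4:ℝ) ^ (a : ℝ))⁻¹ := by
    push_cast
    exact Real.rpow_neg (by norm_num) _
  have hD : ((((2 * a : ℚ)) : ℝ) - 1) = 2 * (a : ℝ) - 1 := by push_cast; ring
  unfold mixCore mixG
  rw [hc, hA, hB, hC, hD]
  field_simp
  ring

/-- **The branch sum: `gL + gR = 2·4^{-a} w^{2a-1}(1-w)^{-½}` on `(0,1)`.** -/
theorem mixGL_add_mixGR (a : ℚ) {w : ℝ} (h0 : 0 < w) (h1 : w < 1) :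
    mixGL a w + mixGR a w = mixG a w := by
  rw [mixGL, mixGR, ← mul_add, nested_radical h0 h1, mixCore_mul_sqrt a h0 h1]

/-! ## Bounds and integrability -/

/-- `0 ≤ mixCore` on `(0,1)`. -/
theorem mixCore_nonneg (a : ℚ) {w : ℝ} (h0 : 0 < w) : 0 ≤ mixCore a w := by
  unfold mixCore
  positivity

/-- `|gL| ≤ G` on `(0,1)`. -/
theorem abs_mixGL_le (a : ℚ) {w : ℝ} (h0 : 0 < w) (h1 : w < 1) : |mixGL a w| ≤ mixG a w := by
  have hc1 : Real.sqrt (1 - w ^ 2) ≤ 1 := by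
    rw [Real.sqrt_le_one]
    nlinarith
  rw [mixGL, abs_of_nonneg (mul_nonneg (mixCore_nonneg a h0) (Real.sqrt_nonneg _)),
    ← mixCore_mul_sqrt a h0 h1]
  exact mul_le_mul_of_nonneg_left (Real.sqrt_le_sqrt (by linarith)) (mixCore_nonneg a h0)

/-- `|gR| ≤ G` on `(0,1)`. -/
theorem abs_mixGR_le (a : ℚ) {w : ℝ} (h0 : 0 < w) (h1 : w < 1) : |mixGR a w| ≤ mixG a w := by
  have hc0 : 0 ≤ Real.sqrt (1 - w ^ 2) := Real.sqrt_nonneg _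
  rw [mixGR, abs_of_nonneg (mul_nonneg (mixCore_nonneg a h0) (Real.sqrt_nonneg _)),
    ← mixCore_mul_sqrt a h0 h1]
  exact mul_le_mul_of_nonneg_left (Real.sqrt_le_sqrt (by linarith)) (mixCore_nonneg a h0)

/-- `gL` is measurable. -/
theorem measurable_mixGL (a : ℚ) : Measurable (mixGL a) := by
  unfold mixGL mixCore
  fun_prop

/-- `gR` is measurable. -/
theorem measurable_mixGR (a : ℚ) : Measurable (mixGR a) := by
  unfold mixGR mixCore
  fun_prop

/-- `G = 2·4^{-a} w^{2a-1}(1-w)^{-½}` is integrable on `(0,1)` for `a > 0`. -/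
theorem integrableOn_mixG (a : ℚ) (ha : 0 < a) : IntegrableOn (mixG a) (Ioo 0 1) :=
  ((integrableOn_Ioo_rpow_mul_one_sub_rpow_and_integral_eq
    (by positivity : (0:ℝ) < (((2 * a : ℚ)) : ℝ))
    (by norm_num : (0:ℝ) < ((((1:ℚ) / 2 : ℚ)) : ℝ))).1).const_mul _

/-- `gL` is integrable on `(0,1)` (dominated by `G`). -/
theorem integrableOn_mixGL (a : ℚ) (ha : 0 < a) : IntegrableOn (mixGL a) (Ioo 0 1) :=
  Integrable.mono' (integrableOn_mixG a ha) (measurable_mixGL a).aestronglyMeasurable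
    ((ae_restrict_iff' measurableSet_Ioo).mpr (ae_of_all _ fun w hw => by
      rw [Real.norm_eq_abs]; exact abs_mixGL_le a hw.1 hw.2))

/-- `gR` is integrable on `(0,1)` (dominated by `G`). -/
theorem integrableOn_mixGR (a : ℚ) (ha : 0 < a) : IntegrableOn (mixGR a) (Ioo 0 1) :=
  Integrable.mono' (integrableOn_mixG a ha) (measurable_mixGR a).aestronglyMeasurable
    ((ae_restrict_iff' measurableSet_Ioo).mpr (ae_of_all _ fun w hw => by
      rw [Real.norm_eq_abs]; exact abs_mixGR_le a hw.1 hw.2))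

/-- `mixFun` is integrable on any subinterval of `(0,1)` for `a > 0`. -/
theorem integrableOn_mixFun (a : ℚ) (ha : 0 < a) {p q : ℝ} (h0 : 0 ≤ p) (h1 : q ≤ 1) :
    IntegrableOn (mixFun a) (Ioo p q) :=
  ((integrableOn_Ioo_rpow_mul_one_sub_rpow_and_integral_eq (Rat.cast_pos.mpr ha)
    (by push_cast; positivity : (0:ℝ) < (((a + 1 / 2 : ℚ)) : ℝ))).1.mono_set
    (Ioo_subset_Ioo h0 h1)).congr_fun (fun _ _ => rfl) measurableSet_Ioo

end SoloBlind

end Summit.KontsevichZagierPeriods.KontsevichZagierPeriods.Theorems
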